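import Summits.BirchSwinnertonDyer.BirchSwinnertonDyer.Theorems.GenusKolyvaginAtTwoGenusPrimitiveSupplyAtTwoTwistSelmerStrictUp
import HarnessLib

/-!
# R-128 retype — print-form twins of `GenusKolyvaginAtTwoGenusPrimitiveSupplyAtTwoTwistSelmerStrictUp`

Seat `bsd-line-gk2-p2` g21 (cell `bsd-f1-sign2`), route `GenusKolyvaginAtTwo`, `--supports stmt-BirchSwinnertonDyer-22136`
(helper; closes nothing). Director-bsd R-128 RETYPE ORDER (2026-08-29 17:42Z; bsd-cited U-r05-BX, T-Q381-1′): the theorems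
`natCard_selmerGroup_twin_eq_two_mul_of_le_strictLocalKer'`, 
of `Summits.BirchSwinnertonDyer.BirchSwinnertonDyer.Theorems.GenusKolyvaginAtTwoGenusPrimitiveSupplyAtTwoTwistSelmerStrictUp` take the BARE closure
`∀ V : WeierstrassCurve ℚ, p_parity V 2` (all Weierstrass cubics, singular included — off print and undischargeable by any
faithful Dokchitser–Dokchitser discharge). This file declares their PRIMED TWINS with the hypothesis in print form
`∀ (V : WeierstrassCurve ℚ) [V.IsElliptic], p_parity V 2` (= route item `TwoParityDD` since rev 34); statements and proofs are
otherwise identical (every application `hpar W` is at an elliptic curve), calls to other retyped theorems go to their twins.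
The tree is append-only, so the originals stay (superseded); the file is over the 400-line budget of the original, hence separate.
THEOREMS ONLY; no definition, no named fact, no `sorry`. BSD is NOT proved by any of this; nothing is closed.
-/

set_option linter.dupNamespace false -- tree convention: `Summit.BirchSwinnertonDyer.BirchSwinnertonDyer.Theorems` (summit = sub-problem)
set_option autoImplicit false

noncomputable section

open scoped Classical ContRepresentation AddSubgroup

namespace Summit.BirchSwinnertonDyer.BirchSwinnertonDyer.Theorems.GenusKolyTwistLocal

open WeierstrassCurve Field NumberField IsDedekindDomain Function
open Literature.NumberTheory.EllipticCurves Literature.NumberTheory.GaloisRepresentations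
open Literature.NumberTheory.GaloisRepresentations.DiscreteGaloisModule (SelmerStructure)
open Literature.NumberTheory.GaloisCohomology
open Summit.BirchSwinnertonDyer.Rank1Residual.X11b.CongruentTransfer
open Summit.BirchSwinnertonDyer.Rank1Residual.X11b.SelmerCount (card_mul_relIndex_of_le)
open Summit.BirchSwinnertonDyer.Rank1Residual.X11b.KummerPT (kummerStrict kummerRelaxed kummerStrict_of_mem
  kummerStrict_of_not_mem)
open Rat.HeightOneSpectrum (primesEquiv natGenerator)
open Literature.NumberTheory.EllipticCurves.ModularForms (exists_isNewformOf)

section Strict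

variable {K : Type} [Field K] [NumberField K] (W Y : WeierstrassCurve K) [W.IsElliptic] (p : ℕ) [hp : Fact p.Prime]

/-! ## R-128 retype (director-bsd 2026-08-29 17:42Z, T-Q381-1′; seat bsd-line-gk2-p2 g21): PRINT-FORM TWINS
Every theorem below is the byte-identical twin of the theorem of the same name without the trailing prime, with the ONE change
that the `2`-parity hypothesis is typed as print has it — `∀ (V : WeierstrassCurve ℚ) [V.IsElliptic], p_parity V 2`
(Dokchitser–Dokchitser 2010 Thm. 1.4, elliptic curves; = route item `TwoParityDD` after rev 34) — instead of the bare closure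
`∀ V : WeierstrassCurve ℚ, p_parity V 2` over all Weierstrass cubics (singular ones included: off print, undischargeable).
Calls to other retyped theorems go to their primed twins; every application `hpar W` is at an elliptic curve, so the proofs are
unchanged. The unprimed originals are kept (append-only tree) and are superseded by these. BSD is NOT proved by any of this. -/

end Strict
section Twist
variable {K : Type} [Field K] [NumberField K] (W : WeierstrassCurve K) [W.IsElliptic]
end Twist
section Rat
variable (W : WeierstrassCurve ℚ)

/-- **R-128 retype** (director-bsd 2026-08-29, T-Q381-1′) of `natCard_selmerGroup_twin_eq_two_mul_of_le_strictLocalKer`: the SAME statement and proof with the `2`-parity hypothesis in PRINT form `∀ (V : WeierstrassCurve ℚ) [V.IsElliptic], p_parity V 2` (Dokchitser–Dokchitser 2010 Thm. 1.4 is about elliptic curves; the bare closure over all Weierstrass cubics was off print). **MAZUR–RUBIN COR. 3.4 (i), UP DIRECTION, FOR THE PRIME HEEGNER TWIN — KERNEL THEOREM modulo Poitou–Tate duality, Tate's local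
Euler characteristic, the 2-parity theorem, the Cassels–Tate pairing and modularity** (the UP half of the print named fact
`MazurRubin2010.cor34i_singleton_rat` as consumed by `GenusKolyTwin.cor34i_twin_prime_heegner`, same currency; the DOWN half is gk2-p5's
`natCard_selmerGroup_eq_two_mul_of_not_le_strictLocalKer`, p624297). Let `W/ℚ` be globally minimal elliptic with `Δ_W < 0` and `ρ̄_{W,2}` onto,
`K` imaginary quadratic with `d_K = −ℓ` odd (`ℓ` prime), Heegner for `N_W`, `2` split in `K`, `Wd` an elliptic model of `W^{(d_K)}`. IF `Sel₂(W)`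
IS strict at `ℓ` (`Sel₂(W) ≤ MazurRubin2010.strictLocalKer W ℚ_ℓ 2`), THEN **`#Sel₂(Wd) = 2 · #Sel₂(W)`**. Proof: `#Sel₂(W) = 2^s ∣ #Sel₂(Wd) =
2^{s'} ∣ 2^{s+1}` (p625846 §29, §36), and `s' ≢ s (mod 2)`: no rational `2`-torsion on `W` (`ρ̄₂` onto) nor on `Wd`
(`Uniform.U2.torsionBy_two_eq_bot_of_twist`), so `(−1)^s = w(W)`, `(−1)^{s'} = w(Wd)` (2-parity + Cassels–Tate), and
`w(Wd) = w(W^{(d_K)}) = −w(W)` (`rootNumber_smul_holds`, `rootNumber_quadraticTwist_discr_eq_neg_of_exists_isNewformOf` under the Heegner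
hypothesis). CONDITIONAL on the displayed hypotheses `hPT`, `hEP` (Milne I 4.10 / 2.8), `hpar` (= route item `TwoParityDD`), `hCT` (= route
item `CasselsTatePairingRat`), `hmod` (= route item `ModularityExistsNewform`) ONLY. BSD is not proved by this.
[cite: MazurRubin2010, Prop. 3.3, Cor. 3.4 (i), Thm. 2.7] [cite: DokchitserDokchitserAnnals2010, Thm. 1.4] [cite: MilneADT2006, I Thm. 4.10, I Thm. 6.13]
[cite: GrossLMS1991, §1 (p. 235)] -/
theorem natCard_selmerGroup_twin_eq_two_mul_of_le_strictLocalKer' [W.IsElliptic] [W.IsGloballyMinimal]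
    {K : Type} [Field K] [NumberField K]
    (hPT : poitouTate_selmerStructure_duality_real ℚ)
    (hEP : ∀ v : HeightOneSpectrum (𝓞 ℚ), localEulerPoincareCharacteristic (v.adicCompletion ℚ))
    (hpar : ∀ (V : WeierstrassCurve ℚ) [V.IsElliptic], p_parity V 2)
    (hCT : WeierstrassCurve.exists_casselsTate_pairing (K := ℚ)) (hmod : exists_isNewformOf)
    (hΔ : W.Δ < 0) (hsurj : W.HasSurjectiveModNGaloisRep 2) (hK : IsImaginaryQuadratic K) (hodd : Odd (discr K))
    (hH : SatisfiesHeegnerHypothesis (W.conductorNorm ℤ) K) (h2K : ((Ideal.span {(2 : ℤ)}).primesOver (𝓞 K)).ncard = 2)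
    {ℓ : ℕ} [Fact ℓ.Prime] (hd : discr K = -(ℓ : ℤ)) (Wd : WeierstrassCurve ℚ) [Wd.IsElliptic]
    (hWd : ∃ C : VariableChange ℚ, C • W.quadraticTwist (discr K : ℚ) = Wd)
    (hs : W.selmerGroup 2 ≤ MazurRubin2010.strictLocalKer W ℚ_[ℓ] 2) :
    Nat.card (Wd.selmerGroup 2) = 2 * Nat.card (W.selmerGroup 2) := by
  haveI : Fact (Nat.Prime 2) := ⟨Nat.prime_two⟩
  have hd0 : (discr K : ℚ) ≠ 0 := by exact_mod_cast NumberField.discr_ne_zero K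
  -- the two divisibilities
  have hlo : Nat.card (W.selmerGroup 2) ∣ Nat.card (Wd.selmerGroup 2) :=
    natCard_selmerGroup_dvd_twin_of_le_strictLocalKer W hΔ hK hH h2K hd Wd hWd hs
  have hhi : Nat.card (Wd.selmerGroup 2) ∣ 2 * Nat.card (W.selmerGroup 2) :=
    natCard_selmerGroup_twin_dvd_two_mul_of_le_strictLocalKer W hPT hEP hΔ hK hodd hH h2K hd Wd hWd hs
  -- exponents
  obtain ⟨s, hsW⟩ := exists_natCard_selmerGroup_eq_pow W 2
  obtain ⟨s', hsWd⟩ := exists_natCard_selmerGroup_eq_pow Wd 2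
  have hsW' : Nat.card (W.selmerGroup 2) = 2 ^ s := hsW
  have hsWd' : Nat.card (Wd.selmerGroup 2) = 2 ^ s' := hsWd
  rw [hsW', hsWd'] at hlo hhi ⊢
  rw [← pow_succ'] at hhi
  have h1 : s ≤ s' := (Nat.pow_dvd_pow_iff_le_right one_lt_two).mp hlo
  have h2 : s' ≤ s + 1 := (Nat.pow_dvd_pow_iff_le_right one_lt_two).mp hhi
  -- parity: `(−1)^s = w(W)`, `(−1)^{s'} = w(Wd) = −w(W)`
  obtain ⟨C, hC⟩ := hWd
  have hbotW : W.toAffine.Point[(2 : ℤ)] = ⊥ := torsionBy_two_eq_bot_of_hasSurjectiveModNGaloisRep_rat W hsurj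
  have hbotWd : Wd.toAffine.Point[(2 : ℤ)] = ⊥ :=
    Summit.BirchSwinnertonDyer.Uniform.U2.torsionBy_two_eq_bot_of_twist W hd0 Wd
      ⟨C⁻¹, by rw [← hC, smul_smul, inv_mul_cancel, one_smul]⟩ hbotW
  have hwW : (-1 : ℤ) ^ s = W.rootNumber := neg_one_pow_eq_rootNumber_of_torsionBy_two_eq_bot W (hpar W) hCT hbotW hsW'
  have hwWd : (-1 : ℤ) ^ s' = Wd.rootNumber :=
    neg_one_pow_eq_rootNumber_of_torsionBy_two_eq_bot Wd (hpar Wd) hCT hbotWd hsWd'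
  have htw : Wd.rootNumber = -W.rootNumber := by
    haveI := W.isElliptic_quadraticTwist hd0
    rw [← rootNumber_quadraticTwist_discr_eq_neg_of_exists_isNewformOf W K hmod hK hH, ← hC]
    exact rootNumber_smul_holds (W.quadraticTwist (discr K : ℚ)) C
  have hne : s' ≠ s := by
    intro heq
    rw [heq, hwW] at hwWd
    rw [← hwWd] at htw
    have h0 : W.rootNumber = 0 := by linarith
    rw [← hwW] at h0
    exact (pow_ne_zero s (by norm_num : (-1 : ℤ) ≠ 0)) h0
  have hs' : s' = s + 1 := by omega
  rw [hs', pow_succ']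


end Rat

end Summit.BirchSwinnertonDyer.BirchSwinnertonDyer.Theorems.GenusKolyTwistLocal

end
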